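import Summits.BirchSwinnertonDyer.BirchSwinnertonDyer.Theorems.ThetaPartnerAtTwoSignedControlAtTwoCoatesGreenbergUnconditional
import Summits.BirchSwinnertonDyer.BirchSwinnertonDyer.Theorems.ThetaPartnerAtTwoSignedControlAtTwoOfPubThreeNotTorsion
import HarnessLib

/-!
# K4 `SignedControlAtTwo` (stmt-BirchSwinnertonDyer-20309) from the three Greenberg §4 facts and (I1)

With the printed input (I2) `WeierstrassCurve.CoatesGreenberg1996_H1_formalGroup_trivial` PROVED at
universe `0` (`CoatesGreenberg1996_H1_formalGroup_trivial_holds`, sibling `…CoatesGreenbergUnconditional`,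
from Tate's almost étale lemma), the K4 assembly `signedControlAtTwo_of_pub3_of_I1_I2`
(`…OfPubThreeNotTorsion`) loses its `hI2` binder: `SignedControlAtTwo` follows from Cassels' Prop. 4.13
(`casselsSurjectivity_H1Sigma ℚ`), Greenberg's Prop. 4.12, the corank bound (conj. 3, proved for `ℚ`
elsewhere) and the relaxed finite-level Selmer count (I1).  CONDITIONAL on those four; BSD is not proved;
no item is closed by this file.

References: [GreenbergLNM1716] Thm. 1.7, §2 p. 84, §4 Props. 4.12–4.13; [CoatesGreenberg1996] Cor. 3.2.
-/

set_option autoImplicit false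
-- the Theorems namespace of this sub repeats the summit name by design (D-0017 nested layout)
set_option linter.dupNamespace false

noncomputable section

open Literature.NumberTheory.EllipticCurves Literature.NumberTheory.GaloisRepresentations

namespace Summit.BirchSwinnertonDyer.BirchSwinnertonDyer.Theorems.SignedEC

/-- **K4 `SignedControlAtTwo` from the three Greenberg §4 facts and (I1)**: `signedControlAtTwo_of_pub3_of_I1_I2`
with `hI2 = (I2)` discharged by `CoatesGreenberg1996_H1_formalGroup_trivial_holds`.  Remaining displayed
inputs: Cassels' Prop. 4.13 (`casselsSurjectivity_H1Sigma ℚ`), Prop. 4.12, the corank bound (proved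
elsewhere for `ℚ`), and (I1).
[cite: GreenbergLNM1716, §1 Thm. 1.7 (pp. 61–62), §2 (p. 84), §4 Props. 4.12–4.13, pp. 119–122]
[cite: CoatesGreenberg1996, Cor. 3.2] -/
theorem signedControlAtTwo_of_pub3_of_I1 (hC : Greenberg1999.casselsSurjectivity_H1Sigma ℚ)
    (h412 : Greenberg1999.prop412_noFiniteSubmodule_H1Sigma_of_rank_one)
    (hcork : Greenberg1999.h1Sigma_zpCorank_le_degree ℚ)
    (hI1 : WeierstrassCurve.relaxedSelmer_torsion_card_growth.{0}) :
    Summit.BirchSwinnertonDyer.BirchSwinnertonDyer.Theses.ThetaPartnerAtTwo.SignedControlAtTwo :=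
  signedControlAtTwo_of_pub3_of_I1_I2 hC h412 hcork hI1 CoatesGreenberg1996_H1_formalGroup_trivial_holds

end Summit.BirchSwinnertonDyer.BirchSwinnertonDyer.Theorems.SignedEC

end
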